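import Literature.AnabelianGeometry.EtaleTheta.ThetaCoversHeisenbergWitness
import Literature.AnabelianGeometry.EtaleTheta.Discharge.Sec2DoubleCoverProofs
import Literature.AnabelianGeometry.EtaleTheta.Discharge.Sec2InversionProofs
import Mathlib.GroupTheory.Commutator.Basic

/-!
# The Heisenberg toy inhabits the hypotheses of [EtTh] Prop 2.2 — the discharged Prop 2.2 / Rmk 2.1.1, NON-VACUOUSLY

Mochizuki, *The Étale Theta Function and its Frobenioid-theoretic Manifestations* [EtTh], Publ. RIMS
45 (2009), §2, Rmk 2.1.1 p.36, Prop 2.2 (i)–(iii) pp.37–38 (bib key `MochizukiEtTh2009`).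

Sequel of `ThetaCoversHeisenbergWitness.lean` (abc-iut-w5-d243, finding NV-L2-d243-1): over the kernel
inhabitant `heisenbergWitness l hl : ThetaCovers.CoverDataAx l` (`l` odd; `Π_C = (ℤ/l × ℤ/l) ⋊ D_l`,
`Π_X` = mod-`l` Heisenberg group, `G_K = 1`, discrete) we exhibit the DATA of Prop 2.2 —
`Π_C̲ := (ℤ/l × ℤ/l) ⋊ {1, s}` (`heisPiCu`, type `(1, l-tors)±`), `Π_X̲ = Π_C̲ ∩ Π_X = (ℤ/l)² ⋊ 1`
(type `(1, l-tors)`, the quotient `Q` being the rotation index `rotChar`), the inversion `ι := s`, the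
`(−1)`-eigenspace `E := {(b, 0)} ⋊ 1` (`heisE`) and the splitting `S := 1` — and prove they satisfy abc-iut-L2-t2's
`IsTypeLTorsPm`, `IsInversion`, `IsMinusEigen`, `IsSplitting`.  CONSEQUENCE: the four DISCHARGED statements
`CoverDataAx.prop22_i_holds` / `prop22_ii_holds` / `prop22_iii_holds` (abc-iut-L2-t10) and `rmk211_holds`
(abc-iut-L2-t2) SPECIALISE to theorems about a concrete finite group (`prop22_i_toy`, `prop22_ii_toy`,
`prop22_iii_toy` — the double-cover index `[⟨Π_X̲̲, ι⟩ : Π_X̲̲] = 2` evaluated —, `rmk211_toy`): their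
hypotheses are jointly satisfiable, so none of them is vacuous.  Also `commutator_sup_barKer`: the
Heisenberg identity `⁅Δ_X, Δ_X⁆ · Ker = Δ̄_Θ` (hypothesis `hΘ` of `TemperedCoverData.rmk261_of`) holds in
the toy.  CONSISTENCY WITNESS ONLY — consistency ≠ faithfulness (print: `Δ_X` free profinite of rank 2,
`G_K = Gal(K̄/K)` of an MLF); nothing here takes a side on anything printed.
[cite: MochizukiEtTh2009, Prop 2.2 p.37] [cite: MochizukiEtTh2009, Rmk 2.1.1 p.36]
-/

namespace Literature.AnabelianGeometry.EtaleTheta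

namespace ThetaCovers

namespace HeisenbergWitness

open Multiplicative

variable (l : ℕ)

/-! ## 3. The hypotheses of Prop 2.2 are inhabited in the toy -/

section Prop22

variable (hl : Odd l)

/-- **`Π_C̲` of the toy**: `(ℤ/l × ℤ/l) ⋊ {1, s}` — the elements whose `D_l`-component is `1` or the
reflection `s = s r^0`. (toy bookkeeping for the typed interface of
[EtTh] Def 2.1 / Prop 2.2; no claim about print) [cite: MochizukiEtTh2009, Def 2.1 p.36] -/
def heisPiCu : Subgroup (heisPiC l) where
  carrier := {x | x.right = 1 ∨ x.right = DihedralGroup.sr 0}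
  mul_mem' := by
    rintro a b (ha | ha) (hb | hb) <;>
      simp only [Set.mem_setOf_eq, SemidirectProduct.mul_right, ha, hb, one_mul, mul_one,
        DihedralGroup.sr_mul_sr, sub_self, DihedralGroup.r_zero, true_or, or_true]
  one_mem' := Or.inl rfl
  inv_mem' := by
    rintro a (ha | ha)
    · exact Or.inl (by simp [ha])
    · exact Or.inr (by simp [ha])

/-- `Π_C̲ ∩ Π_X = (ℤ/l × ℤ/l) ⋊ 1` (`= Ker(Π_C ↠ D_l)`), i.e. `Π_X̲`: membership. (toy bookkeeping for the typed interface of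
[EtTh] Def 2.1 / Prop 2.2; no claim about print) [cite: MochizukiEtTh2009, Def 2.1 p.36] -/
theorem mem_heisPiCu_inf {x : heisPiC l} : x ∈ heisPiCu l ⊓ heisPiX l ↔ x.right = 1 := by
  rw [Subgroup.mem_inf, mem_heisPiX]
  constructor
  · rintro ⟨h | h, ⟨i, hi⟩⟩
    · exact h
    · rw [h] at hi; cases hi
  · intro h
    exact ⟨Or.inl h, ⟨0, by rw [h, DihedralGroup.one_def]⟩⟩

/-- The rotation-index character `Π_X̲ = (ℤ/l × ℤ/l) ⋊ 1 ↪ Π_X ↠ ℤ/l`, `(n, r^a) ↦ a`, on `Π_X`: the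
quotient `Q` of Def 2.1 in the toy (its kernel is `Π_X̲`). (toy bookkeeping for the typed interface of
[EtTh] Def 2.1 / Prop 2.2; no claim about print) [cite: MochizukiEtTh2009, Def 2.1 p.36] -/
def rotChar : ↥(heisPiX l) →* Multiplicative (ZMod l) where
  toFun x := ofAdd (rotIdx l x.1.right)
  map_one' := by simp
  map_mul' x y := by
    obtain ⟨i, hi⟩ := (mem_heisPiX l).mp x.2
    obtain ⟨j, hj⟩ := (mem_heisPiX l).mp y.2
    apply toAdd.injective
    simp [hi, hj, toAdd_mul]

/-- `Π_X̲ := Π_C̲ ∩ Π_X` is of type `(1, l-tors)` in the toy. (toy bookkeeping for the typed interface of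
[EtTh] Def 2.1 / Prop 2.2; no claim about print) [cite: MochizukiEtTh2009, Def 2.1 p.36] -/
theorem isTypeLTors_inf : (heisenbergWitness l hl).toCoverData.IsTypeLTors (heisPiCu l ⊓ heisPiX l) := by
  refine ⟨inf_le_right, ⟨rotChar l, ?_, ?_⟩, ?_, ?_, ?_⟩
  · intro y
    obtain ⟨a, rfl⟩ := Multiplicative.ofAdd.surjective y
    exact ⟨⟨SemidirectProduct.inr (DihedralGroup.r a), (mem_heisPiX l).mpr ⟨a, rfl⟩⟩, rfl⟩
  · intro g
    obtain ⟨i, hi⟩ := (mem_heisPiX l).mp g.2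
    rw [mem_heisPiCu_inf, hi, DihedralGroup.one_def, DihedralGroup.r.injEq]
    constructor
    · intro h
      have := congrArg toAdd h
      simpa [rotChar, hi] using this
    · intro h
      apply toAdd.injective
      simp [rotChar, hi, h]
  · intro x hx
    exact (mem_heisPiCu_inf l).mpr ((mem_heisTheta l).mp hx).1
  · -- `Π_X̲ · Δ_X = Π_X`, with `Δ_X = Π_X ∩ Ker(1) = Π_X`
    refine le_antisymm (sup_le inf_le_right inf_le_left) fun x hx => ?_
    exact Subgroup.mem_sup_right ⟨hx, mem_ker_one l x⟩
  · intro x hx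
    exact (mem_heisPiCu_inf l).mpr ((mem_heisTheta l).mp hx).1

/-- `Π_C̲` is of type `(1, l-tors)±` in the toy: `[Π_C̲ : Π_X̲] = 2`. (toy bookkeeping for the typed interface of
[EtTh] Def 2.1 / Prop 2.2; no claim about print) [cite: MochizukiEtTh2009, Def 2.1 p.36] -/
theorem isTypeLTorsPm_heisPiCu : (heisenbergWitness l hl).toCoverData.IsTypeLTorsPm (heisPiCu l) := by
  refine ⟨isTypeLTors_inf l hl, ?_⟩
  rw [Subgroup.relIndex_eq_two_iff]
  refine ⟨SemidirectProduct.inr (DihedralGroup.sr 0), Or.inr rfl, fun b hb => ?_⟩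
  rcases hb with hb | hb
  · refine Or.inr ⟨(mem_heisPiCu_inf l).mpr hb, fun h => ?_⟩
    have h' := (mem_heisPiCu_inf l).mp h
    rw [SemidirectProduct.mul_right, hb, one_mul, SemidirectProduct.right_inr] at h'
    cases h'
  · refine Or.inl ⟨(mem_heisPiCu_inf l).mpr ?_, fun h => ?_⟩
    · rw [SemidirectProduct.mul_right, hb, SemidirectProduct.right_inr, DihedralGroup.sr_mul_sr, sub_self,
        DihedralGroup.r_zero]
    · have h' := (mem_heisPiCu_inf l).mp h
      rw [hb] at h'
      cases h'

/-- The reflection `s` is an inversion for `Π_C̲` in the toy. (toy bookkeeping for the typed interface of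
[EtTh] Def 2.1 / Prop 2.2; no claim about print) [cite: MochizukiEtTh2009, Def 2.1 p.36] -/
theorem isInversion_s : (heisenbergWitness l hl).toCoverData.IsInversion (heisPiCu l)
    (SemidirectProduct.inr (DihedralGroup.sr 0)) :=
  ⟨Or.inr rfl, mem_ker_one l _, fun h => by
    obtain ⟨i, hi⟩ := (mem_heisPiX l).mp h
    cases hi⟩

/-- **The `(−1)`-eigenspace `E := {(b, 0)} ⋊ 1`** (`Δ̄^ell_X̲`-preimage) of the toy. (toy bookkeeping for the typed interface of
[EtTh] Def 2.1 / Prop 2.2; no claim about print) [cite: MochizukiEtTh2009, Def 2.1 p.36] -/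
def heisE : Subgroup (heisPiC l) where
  carrier := {x | x.right = 1 ∧ γ l x = 0}
  mul_mem' := by
    rintro a b ⟨ha1, ha2⟩ ⟨hb1, hb2⟩
    exact ⟨by simp [ha1, hb1], by simp [ha1, ha2, hb2]⟩
  one_mem' := ⟨rfl, γ_one l⟩
  inv_mem' := by
    rintro a ⟨ha1, ha2⟩
    exact ⟨by simp [ha1], by simp [ha1, ha2]⟩

/-- Membership in `E`. (toy bookkeeping for the typed interface of
[EtTh] Def 2.1 / Prop 2.2; no claim about print) [cite: MochizukiEtTh2009, Def 2.1 p.36] -/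
theorem mem_heisE {x : heisPiC l} : x ∈ heisE l ↔ x.right = 1 ∧ γ l x = 0 := Iff.rfl

/-- `E` is the `(−1)`-eigenspace datum `Im(s_ι)` of Prop 2.2 (i) for `(Π_X̲, Π_C̲, s)` in the toy. (toy bookkeeping for the typed interface of
[EtTh] Def 2.1 / Prop 2.2; no claim about print) [cite: MochizukiEtTh2009, Def 2.1 p.36] -/
theorem isMinusEigen_heisE : (heisenbergWitness l hl).toCoverData.IsMinusEigen (heisPiCu l ⊓ heisPiX l)
    (heisPiCu l) (SemidirectProduct.inr (DihedralGroup.sr 0)) (heisE l) := by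
  refine ⟨bot_le, ?_, ?_, ?_, ?_, ?_, ?_, ?_⟩
  · intro x hx
    exact ⟨(mem_heisPiCu_inf l).mpr ((mem_heisE l).mp hx).1, mem_ker_one l x⟩
  · intro g hg e he
    have hg1 := (mem_heisPiCu_inf l).mp hg
    obtain ⟨he1, he2⟩ := (mem_heisE l).mp he
    exact ⟨by simp [hg1, he1], by simp [hg1, he1, he2]⟩
  · refine le_antisymm ?_ bot_le
    rintro x ⟨hxE, hxT⟩
    rw [Subgroup.mem_bot]
    exact eq_one_of_coords l ((mem_heisE l).mp hxE).1 ((mem_heisTheta l).mp hxT).2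
      ((mem_heisE l).mp hxE).2
  · refine le_antisymm (sup_le ?_ ?_) fun x hx => ?_
    · intro x hx
      exact ⟨(mem_heisPiCu_inf l).mpr ((mem_heisE l).mp hx).1, mem_ker_one l x⟩
    · intro x hx
      exact ⟨(mem_heisPiCu_inf l).mpr ((mem_heisTheta l).mp hx).1, mem_ker_one l x⟩
    · -- `x = (b, c) ⋊ 1 = ((b, 0) ⋊ 1) · ((0, c) ⋊ 1)`
      have hx1 : x.right = 1 := (mem_heisPiCu_inf l).mp hx.1
      have hsplit : x = SemidirectProduct.inl (ofAdd ((β l x, 0) : ZMod l × ZMod l)) *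
          SemidirectProduct.inl (ofAdd ((0, γ l x) : ZMod l × ZMod l)) :=
        ext_of_coords l (by simp [hx1]) (by simp) (by simp)
      rw [hsplit]
      exact Subgroup.mul_mem _ (Subgroup.mem_sup_left ⟨rfl, by simp⟩)
        (Subgroup.mem_sup_right ⟨rfl, by simp⟩)
  · intro e he
    obtain ⟨he1, he2⟩ := (mem_heisE l).mp he
    rw [Subgroup.mem_bot]
    exact eq_one_of_coords l (by simp [he1]) (by simp [he1]) (by simp [he1, he2])
  · intro t ht
    obtain ⟨ht1, ht2⟩ := (mem_heisTheta l).mp ht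
    rw [Subgroup.mem_bot]
    exact eq_one_of_coords l (by simp [ht1]) (by simp [ht1, ht2]) (by simp [ht1, ht2])
  · intro e he
    obtain ⟨he1, he2⟩ := (mem_heisE l).mp he
    exact ⟨by simp [he1], by simp [he1, he2]⟩

/-- The trivial subgroup is a splitting of `D̄_x ↠ G_K` in the toy (`G_K = 1`). (toy bookkeeping for the typed interface of
[EtTh] Def 2.1 / Prop 2.2; no claim about print) [cite: MochizukiEtTh2009, Def 2.1 p.36] -/
theorem isSplitting_bot : (heisenbergWitness l hl).toCoverData.IsSplitting ⊥ :=
  ⟨le_rfl, bot_le, bot_inf_eq _, fun _ => ⟨1, Subsingleton.elim _ _⟩⟩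

/-- `s² = 1 ∈ Ker`: the reflection has order `2`. (toy bookkeeping for the typed interface of
[EtTh] Def 2.1 / Prop 2.2; no claim about print) [cite: MochizukiEtTh2009, Def 2.1 p.36] -/
theorem s_mul_s_mem : SemidirectProduct.inr (DihedralGroup.sr 0) * SemidirectProduct.inr (DihedralGroup.sr 0) ∈
    (heisenbergWitness l hl).barKer := by
  show _ ∈ (⊥ : Subgroup (heisPiC l))
  rw [Subgroup.mem_bot, ← map_mul, DihedralGroup.sr_mul_self, map_one]

/-- **Prop 2.2 (ii), NON-VACUOUSLY**: the discharged `prop22_ii_holds` SPECIALISED to the toy data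
`(Π_X̲, Π_C̲, E, S, ι) = ((ℤ/l)² ⋊ 1, (ℤ/l)² ⋊ {1,s}, {(b,0)}, 1, s)`. [cite: MochizukiEtTh2009, Prop 2.2(ii) p.37] -/
theorem prop22_ii_toy :
    (heisenbergWitness l hl).Dx ⊔ heisE l = heisPiCu l ⊓ heisPiX l ∧
      (heisenbergWitness l hl).Dx ⊓ heisE l ≤ (heisenbergWitness l hl).barKer ∧
      (⊥ ⊔ heisE l) ⊓ (heisenbergWitness l hl).toCoverData.DeltaC = heisE l :=
  (heisenbergWitness l hl).prop22_ii_holds _ _ _ _ _ (isTypeLTorsPm_heisPiCu l hl) rfl (isInversion_s l hl)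
    (isMinusEigen_heisE l hl) (isSplitting_bot l hl)

/-- **Prop 2.2 (iii), NON-VACUOUSLY**: in the toy, `Π_C̲̲ := ⟨Π_X̲̲, s⟩` with `Π_X̲̲ = S · E = E` satisfies
`Π_C̲̲ ∩ Π_X̲ = Π_X̲̲` and `[Π_C̲̲ : Π_X̲̲] = 2` — the double covering of the cartesian diagram, evaluated
on a finite group. [cite: MochizukiEtTh2009, Prop 2.2(iii) p.37] -/
theorem prop22_iii_toy (hl : Odd l) :
    ((⊥ ⊔ heisE l) ⊔ Subgroup.zpowers (SemidirectProduct.inr (DihedralGroup.sr 0))) ⊓ (heisPiCu l ⊓ heisPiX l)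
        = ⊥ ⊔ heisE l ∧
      (⊥ ⊔ heisE l).relIndex ((⊥ ⊔ heisE l) ⊔ Subgroup.zpowers (SemidirectProduct.inr (DihedralGroup.sr 0)))
        = 2 :=
  ((heisenbergWitness l hl).prop22_iii_holds _ _ _ _ _ (isTypeLTorsPm_heisPiCu l hl) rfl
    (isInversion_s l hl) (isMinusEigen_heisE l hl) (isSplitting_bot l hl)).2 (s_mul_s_mem l hl)

/-- **Prop 2.2 (i), NON-VACUOUSLY**: the discharged `prop22_i_holds` at the toy data yields a UNIQUE
`(−1)`-eigenspace datum, which is `E = {(b, 0)}`. [cite: MochizukiEtTh2009, Prop 2.2(i) p.37] -/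
theorem prop22_i_toy : ∃! E' : Subgroup (heisPiC l),
    (heisenbergWitness l hl).toCoverData.IsMinusEigen (heisPiCu l ⊓ heisPiX l) (heisPiCu l)
      (SemidirectProduct.inr (DihedralGroup.sr 0)) E' :=
  (heisenbergWitness l hl).prop22_i_holds _ _ _ (isTypeLTorsPm_heisPiCu l hl) rfl (isInversion_s l hl)

/-- **Rmk 2.1.1, NON-VACUOUSLY**: `N_{Π_C}(Π_C̲) ∩ Π_X = Π_X̲` in the toy. [cite: MochizukiEtTh2009, Rmk 2.1.1 p.36] -/
theorem rmk211_toy (hl : Odd l) :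
    Subgroup.normalizer (heisPiCu l : Set (heisPiC l)) ⊓ heisPiX l = heisPiCu l ⊓ heisPiX l :=
  (heisenbergWitness l hl).rmk211_holds _ (isTypeLTorsPm_heisPiCu l hl)

/-- **The Heisenberg identity `⁅Δ_X, Δ_X⁆ · Ker = Δ̄_Θ`** (hypothesis `hΘ` of
`TemperedCoverData.rmk261_of` / `barTheta_cyclic_of_commutator`) holds in the toy: the commutator
subgroup of the mod-`l` Heisenberg group is its centre. (toy bookkeeping for the typed interface of
[EtTh] Def 2.1 / Prop 2.2; no claim about print) [cite: MochizukiEtTh2009, Def 2.1 p.36] -/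
theorem commutator_sup_barKer :
    ⁅(heisenbergWitness l hl).toCoverData.DeltaX, (heisenbergWitness l hl).toCoverData.DeltaX⁆ ⊔
      (heisenbergWitness l hl).barKer = (heisenbergWitness l hl).barTheta := by
  show ⁅heisPiX l ⊓ (1 : heisPiC l →* PUnit).ker, heisPiX l ⊓ (1 : heisPiC l →* PUnit).ker⁆ ⊔ ⊥ = heisTheta l
  rw [sup_bot_eq, MonoidHom.ker_one, inf_top_eq]
  refine le_antisymm ?_ fun t ht => ?_
  · rw [Subgroup.commutator_le]
    intro x hx y hy
    obtain ⟨i, hi⟩ := (mem_heisPiX l).mp hx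
    obtain ⟨j, hj⟩ := (mem_heisPiX l).mp hy
    refine (mem_heisTheta l).mpr ⟨?_, ?_⟩
    · simp only [commutatorElement_def, SemidirectProduct.mul_right, SemidirectProduct.inv_right, hi, hj,
        DihedralGroup.inv_r, DihedralGroup.r_mul_r, DihedralGroup.one_def]
      exact congrArg DihedralGroup.r (by ring)
    · simp [commutatorElement_def, hi, hj]
  · obtain ⟨ht1, ht2⟩ := (mem_heisTheta l).mp ht
    -- `(0, c) ⋊ 1 = [(−c, 0) ⋊ 1, 1 ⋊ r]` (a commutator of two elements of `Π_X`)
    set a : heisPiC l := SemidirectProduct.inl (ofAdd ((-γ l t, 0) : ZMod l × ZMod l)) with ha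
    set b : heisPiC l := SemidirectProduct.inr (DihedralGroup.r 1) with hb
    have key : t = a * b * a⁻¹ * b⁻¹ :=
      ext_of_coords l (by simp [ha, hb, ht1]) (by simp [ha, hb, ht2]) (by simp [ha, hb])
    rw [key]
    exact Subgroup.commutator_mem_commutator ((mem_heisPiX l).mpr ⟨0, by rw [ha]; rfl⟩)
      ((mem_heisPiX l).mpr ⟨1, by rw [hb]; rfl⟩)

end Prop22

end HeisenbergWitness

end ThetaCovers

end Literature.AnabelianGeometry.EtaleTheta
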